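import Mathlib
import HarnessLib
import Summits.ResolutionOfSingularities.ResolutionOfSingularities.Theorems.WildQuotientsWildQuotientResolutionPeelingFrameKLWitness
import Summits.ResolutionOfSingularities.ResolutionOfSingularities.Theorems.WildQuotientsWildQuotientResolutionFixedPointsRegular

/-!
# ℤ9 SPECIMEN (peeled `𝔸⁴/ℤ9`, char 3), brick Z4a — Király–Lütkebohmert on the `x_a`-ROOT chart:
# the lifted automorphism, `σ̃³ = 1`, `I_σ̃ = (s³)`, and the invariant ring is REGULAR

(crux stmt-ResolutionOfSingularities-15640 `WildQuotients.WildQuotientResolution`, line `Sketch`; S1 =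
stmt-ResolutionOfSingularities-17941 `CyclicQuotientFourfolds`, non-linear sector; chain w45c card P specimen
«peeled 𝔸⁴/ℤ9» — res-L1-w45c-idea-2 memo `L/res-L1-w45c-idea-2/cardP_g12/Z9-SPECIMEN.md` §2 «x₀-chart (μ₇
root chart)» / §4 brick Z4a, res-L1-w45c-plan-1 ORDER 2026-08-27T16:36:47Z («Z4a K–L brick = stub-3») and GO
16:29:20Z (variant V-BR). [OURS · L1 W4.5c] — NOT a statement of any manuscript; replaces the role of no
printed item; AI-produced, weaker than expert review. Def-free, LAW-BASED in the lifted automorphism.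
Letters of res-L1-w45c-stub-1's Z0 `…Z9PeeledPeel` (`k`, `n`, `a b c d : Fin n`, passengers `i ∉ {b,c,d}`).
Prover res-L1-w45c-stub-3.)

The peeled action on `P = k[x₁,…,xₙ]` is `τ x_a = x_a`, `τ x_b = x_b + x_a`, `τ x_c = x_c + x_b`,
`τ x_d = x_d + x_c³ − x_a² x_c`, passengers fixed (Z0 `exists_descended`). The `x_a`-ROOT CHART of the
`(7,4,1 | 0)`-weighted blow-up is the same polynomial ring `P` with index `a` now carrying the root `s`
(`x_a = s⁷`, `x_b = s⁴ x_b′`, `x_c = s x_c′`, `x_d = x_d`): the root substitution `rootSubstA` below. The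
LIFTED AUTOMORPHISM `ξ` (memo §2, polynomial and `s`-preserving) is
  `ξ s = s`, `ξ x_b′ = x_b′ + s³`, `ξ x_c′ = x_c′ + s³ x_b′`, `ξ x_d = x_d + s³ (x_c′³ − s¹² x_c′)`, passengers fixed.

* `exists_rootLiftA` — such a `ξ : P ≃ₐ[k] P` exists (explicit inverse; any characteristic);
* `aeval_rootSubstA_comp` — INTERTWINING `rootSubstA (τ f) = ξ (rootSubstA f)` (any characteristic);
* `rootLiftA_pow_three_apply_X_b/_c/_d`, `rootLiftA_pow_three_eq_one` — `ξ³ = 1` in characteristic `3`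
  (on `x_d`: `ξ³ x_d = x_d + 3·s³·Q` with an explicit `Q`);
* `rootLiftA_sub_X_b`, `span_rootLiftA_sub_eq` — the AUGMENTATION IDEAL IS PRINCIPAL: `(ξ u − u : u) = (s³)`
  (`⊇`: `ξ x_b′ − x_b′ = s³`; `⊆`: every generator increment is a multiple of `s³`, then PF-A
  `PeelingFrame.forall_sub_mem_of_adjoin_eq_top`);
* `rootLiftA_KL_terminal` — hence the Király–Lütkebohmert terminal state: at EVERY prime the localised
  augmentation ideal is principal (the `hdiv` of `TameTransfer.isRegularRing_fixedPoints_zpowers`, verbatim shape);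
* **`rootLiftA_fixedPoints_isRegularRing`** — `S := P^{⟨ξ⟩}` is a REGULAR ring (characteristic `3`), the V-BR
  input «`S = k[s, x₁′, x₂′, w]^{σ̃}` regular by K–L» of memo §2/§3.
-/

-- single-problem summit: the doubled namespace component `ResolutionOfSingularities` is forced
set_option linter.dupNamespace false

noncomputable section

open MvPolynomial

namespace Summit.ResolutionOfSingularities.ResolutionOfSingularities.Theorems.WildQuotientResolution.Z9Peeled

variable (k : Type) [Field k] (n : ℕ) (a b c d : Fin n)
  (hab : a ≠ b) (hac : a ≠ c) (had : a ≠ d) (hbc : b ≠ c) (hbd : b ≠ d) (hcd : c ≠ d)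

/-! ## The lifted automorphism on the root chart exists -/

include hab hac had hbc hbd hcd in
/-- **The lift `ξ` of the peeled action to the `x_a`-root chart exists**: `ξ s = s`, `ξ x_b′ = x_b′ + s³`,
`ξ x_c′ = x_c′ + s³ x_b′`, `ξ x_d = x_d + s³(x_c′³ − s¹² x_c′)`, passengers fixed (explicit inverse
`x_b′ ↦ x_b′ − s³`, `x_c′ ↦ x_c′ − s³(x_b′ − s³)`, `x_d ↦ x_d − s³(C³ − s¹²C)` with `C = x_c′ − s³(x_b′ − s³)`;
any characteristic). [OURS · L1 W4.5c] -/
theorem exists_rootLiftA :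
    ∃ ξ : MvPolynomial (Fin n) k ≃ₐ[k] MvPolynomial (Fin n) k,
      ξ (X a) = X a ∧ ξ (X b) = X b + X a ^ 3 ∧ ξ (X c) = X c + X a ^ 3 * X b ∧
        ξ (X d) = X d + X a ^ 3 * (X c ^ 3 - X a ^ 12 * X c) ∧
        ∀ i, i ≠ b → i ≠ c → i ≠ d → ξ (X i) = X i := by
  classical
  let φ : MvPolynomial (Fin n) k →ₐ[k] MvPolynomial (Fin n) k :=
    aeval fun i => if i = b then X b + X a ^ 3 else if i = c then X c + X a ^ 3 * X b
      else if i = d then X d + X a ^ 3 * (X c ^ 3 - X a ^ 12 * X c) else X i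
  let C' : MvPolynomial (Fin n) k := X c - X a ^ 3 * (X b - X a ^ 3)
  let φ' : MvPolynomial (Fin n) k →ₐ[k] MvPolynomial (Fin n) k :=
    aeval fun i => if i = b then X b - X a ^ 3 else if i = c then C'
      else if i = d then X d - X a ^ 3 * (C' ^ 3 - X a ^ 12 * C') else X i
  have hφb : φ (X b) = X b + X a ^ 3 := by simp [φ]
  have hφc : φ (X c) = X c + X a ^ 3 * X b := by simp [φ, Ne.symm hbc]
  have hφd : φ (X d) = X d + X a ^ 3 * (X c ^ 3 - X a ^ 12 * X c) := by
    simp [φ, Ne.symm hbd, Ne.symm hcd]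
  have hφi : ∀ i, i ≠ b → i ≠ c → i ≠ d → φ (X i) = X i := by
    intro i hib hic hid; simp [φ, hib, hic, hid]
  have hφ'b : φ' (X b) = X b - X a ^ 3 := by simp [φ']
  have hφ'c : φ' (X c) = C' := by simp [φ', Ne.symm hbc]
  have hφ'd : φ' (X d) = X d - X a ^ 3 * (C' ^ 3 - X a ^ 12 * C') := by
    simp [φ', Ne.symm hbd, Ne.symm hcd]
  have hφ'i : ∀ i, i ≠ b → i ≠ c → i ≠ d → φ' (X i) = X i := by
    intro i hib hic hid; simp [φ', hib, hic, hid]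
  have hφa : φ (X a) = X a := hφi a hab hac had
  have hφ'a : φ' (X a) = X a := hφ'i a hab hac had
  have h1 : φ.comp φ' = AlgHom.id k _ := by
    refine MvPolynomial.algHom_ext fun i => ?_
    change φ (φ' (X i)) = X i
    by_cases hib : i = b
    · rw [hib, hφ'b, map_sub, map_pow, hφb, hφa]; ring
    by_cases hic : i = c
    · rw [hic, hφ'c]
      simp only [C', map_sub, map_mul, map_pow, hφc, hφb, hφa]; ring
    by_cases hid : i = d
    · rw [hid, hφ'd]
      simp only [C', map_sub, map_pow, map_mul, hφd, hφc, hφb, hφa]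
      ring
    · rw [hφ'i i hib hic hid, hφi i hib hic hid]
  have h2 : φ'.comp φ = AlgHom.id k _ := by
    refine MvPolynomial.algHom_ext fun i => ?_
    change φ' (φ (X i)) = X i
    by_cases hib : i = b
    · rw [hib, hφb, map_add, map_pow, hφ'b, hφ'a]; ring
    by_cases hic : i = c
    · rw [hic, hφc, map_add, map_mul, map_pow, hφ'c, hφ'b, hφ'a]; simp only [C']; ring
    by_cases hid : i = d
    · rw [hid, hφd]
      simp only [map_sub, map_add, map_pow, map_mul, hφ'd, hφ'c, hφ'a, C']
      ring
    · rw [hφi i hib hic hid, hφ'i i hib hic hid]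
  exact ⟨AlgEquiv.ofAlgHom φ φ' h1 h2, hφa, hφb, hφc, hφd, hφi⟩

/-! ## Laws of the lift, intertwining with the peeled action -/

variable (τ ξ : MvPolynomial (Fin n) k ≃ₐ[k] MvPolynomial (Fin n) k)
  (hτa : τ (X a) = X a) (hτb : τ (X b) = X b + X a) (hτc : τ (X c) = X c + X b)
  (hτd : τ (X d) = X d + X c ^ 3 - X a ^ 2 * X c) (hτ : ∀ i, i ≠ b → i ≠ c → i ≠ d → τ (X i) = X i)
  (hξa : ξ (X a) = X a) (hξb : ξ (X b) = X b + X a ^ 3) (hξc : ξ (X c) = X c + X a ^ 3 * X b)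
  (hξd : ξ (X d) = X d + X a ^ 3 * (X c ^ 3 - X a ^ 12 * X c))
  (hξ : ∀ i, i ≠ b → i ≠ c → i ≠ d → ξ (X i) = X i)

include hab hac had hbc hbd hcd hτa hτb hτc hτd hτ hξa hξb hξc hξd hξ in
/-- **Intertwining.** The root substitution `x_a ↦ s⁷, x_b ↦ s⁴ x_b′, x_c ↦ s x_c′` (else identity)
carries the peeled action `τ` to the lift `ξ`: `rootSubstA ∘ τ = ξ ∘ rootSubstA` (any characteristic).
[OURS · L1 W4.5c] -/
theorem aeval_rootSubstA_comp (f : MvPolynomial (Fin n) k) :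
    aeval (fun i : Fin n => if i = a then X a ^ 7 else if i = b then X a ^ 4 * X b
        else if i = c then X a * X c else (X i : MvPolynomial (Fin n) k)) (τ f)
      = ξ (aeval (fun i : Fin n => if i = a then X a ^ 7 else if i = b then X a ^ 4 * X b
        else if i = c then X a * X c else (X i : MvPolynomial (Fin n) k)) f) := by
  classical
  set ψ : MvPolynomial (Fin n) k →ₐ[k] MvPolynomial (Fin n) k := aeval (fun i : Fin n =>
    if i = a then X a ^ 7 else if i = b then X a ^ 4 * X b else if i = c then X a * X c
    else (X i : MvPolynomial (Fin n) k)) with hψ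
  have hψa : ψ (X a) = X a ^ 7 := by simp [hψ]
  have hψb : ψ (X b) = X a ^ 4 * X b := by simp [hψ, Ne.symm hab]
  have hψc : ψ (X c) = X a * X c := by simp [hψ, Ne.symm hac, Ne.symm hbc]
  have hψd : ψ (X d) = X d := by simp [hψ, Ne.symm had, Ne.symm hbd, Ne.symm hcd]
  have hψi : ∀ i, i ≠ a → i ≠ b → i ≠ c → ψ (X i) = X i := by
    intro i hia hib hic; simp [hψ, hia, hib, hic]
  have key : (ψ.comp (τ : MvPolynomial (Fin n) k →ₐ[k] MvPolynomial (Fin n) k))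
      = ((ξ : MvPolynomial (Fin n) k →ₐ[k] MvPolynomial (Fin n) k)).comp ψ := by
    refine MvPolynomial.algHom_ext fun i => ?_
    change ψ (τ (X i)) = ξ (ψ (X i))
    by_cases hia : i = a
    · rw [hia, hτa, hψa, map_pow, hξa]
    by_cases hib : i = b
    · rw [hib, hτb, map_add, hψb, hψa, map_mul, map_pow, hξa, hξb]; ring
    by_cases hic : i = c
    · rw [hic, hτc, map_add, hψc, hψb, map_mul, hξa, hξc]; ring
    by_cases hid : i = d
    · rw [hid, hτd, map_sub, map_add, map_pow, map_mul, map_pow, hψd, hψc, hψa, hξd]; ring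
    · rw [hτ i hib hic hid, hψi i hia hib hic, hξ i hib hic hid]
  exact congrArg (fun χ : MvPolynomial (Fin n) k →ₐ[k] MvPolynomial (Fin n) k => χ f) key

/-! ## `ξ³ = 1` in characteristic 3 -/

include hξa hξb in
/-- `ξ³ x_b′ = x_b′` (`= x_b′ + 3 s³`). [OURS · L1 W4.5c] -/
theorem rootLiftA_pow_three_apply_X_b [CharP k 3] : ξ (ξ (ξ (X b))) = X b := by
  have h3 : (3 : MvPolynomial (Fin n) k) = 0 := CharP.cast_eq_zero _ 3
  have h : ξ (ξ (ξ (X b))) = X b + 3 * X a ^ 3 := by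
    simp only [hξb, hξa, map_add, map_pow]; ring
  rw [h, h3, zero_mul, add_zero]

include hξa hξb hξc in
/-- `ξ³ x_c′ = x_c′` (`= x_c′ + 3 s³ x_b′ + 3 s⁶`). [OURS · L1 W4.5c] -/
theorem rootLiftA_pow_three_apply_X_c [CharP k 3] : ξ (ξ (ξ (X c))) = X c := by
  have h3 : (3 : MvPolynomial (Fin n) k) = 0 := CharP.cast_eq_zero _ 3
  have h : ξ (ξ (ξ (X c))) = X c + 3 * (X a ^ 3 * X b + X a ^ 6) := by
    simp only [hξc, hξb, hξa, map_add, map_mul, map_pow]; ring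
  rw [h, h3, zero_mul, add_zero]

include hξa hξb hξc hξd in
/-- `ξ³ x_d = x_d` (`= x_d + 3 s³ Q`, `Q` explicit — the `−s¹² x_c′` term of the peel is what makes the
cubes cancel: `Σ_m ξ^m x_c′ = s⁶` and `Σ_m (ξ^m x_c′)³ = s¹⁸` in characteristic 3). [OURS · L1 W4.5c] -/
theorem rootLiftA_pow_three_apply_X_d [CharP k 3] : ξ (ξ (ξ (X d))) = X d := by
  have h3 : (3 : MvPolynomial (Fin n) k) = 0 := CharP.cast_eq_zero _ 3
  have h : ξ (ξ (ξ (X d))) = X d + 3 * (X a ^ 3 * (X c ^ 3 + 3 * X a ^ 3 * X b * X c ^ 2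
      + 5 * X a ^ 6 * X b ^ 2 * X c + X a ^ 6 * X c ^ 2 + 4 * X a ^ 9 * X b * X c
      + 3 * X a ^ 9 * X b ^ 3 + 4 * X a ^ 12 * X b ^ 2 + X a ^ 15 * X b)) := by
    simp only [hξd, hξc, hξb, hξa, map_add, map_sub, map_mul, map_pow]; ring
  rw [h, h3, zero_mul, add_zero]

include hξa hξb hξc hξd hξ in
/-- **`ξ³ = 1`** in characteristic `3`. [OURS · L1 W4.5c] -/
theorem rootLiftA_pow_three_eq_one [CharP k 3] : ξ ^ 3 = 1 := by
  have h3 : ∀ f, (ξ ^ 3) f = ξ (ξ (ξ f)) := fun f => by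
    rw [pow_succ, pow_two, AlgEquiv.mul_apply, AlgEquiv.mul_apply]
  apply AlgEquiv.coe_toAlgHom_injective
  refine MvPolynomial.algHom_ext fun i => ?_
  change (ξ ^ 3) (X i) = (1 : MvPolynomial (Fin n) k ≃ₐ[k] MvPolynomial (Fin n) k) (X i)
  rw [h3, AlgEquiv.one_apply]
  by_cases hib : i = b
  · rw [hib]; exact rootLiftA_pow_three_apply_X_b k n a b ξ hξa hξb
  by_cases hic : i = c
  · rw [hic]; exact rootLiftA_pow_three_apply_X_c k n a b c ξ hξa hξb hξc
  by_cases hid : i = d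
  · rw [hid]; exact rootLiftA_pow_three_apply_X_d k n a b c d ξ hξa hξb hξc hξd
  · rw [hξ i hib hic hid, hξ i hib hic hid, hξ i hib hic hid]

/-! ## The augmentation ideal is `(s³)`; Király–Lütkebohmert -/

include hξb in
/-- `ξ x_b′ − x_b′ = s³`: the augmentation ideal contains `s³`. [OURS · L1 W4.5c] -/
theorem rootLiftA_sub_X_b : ξ (X b) - X b = X a ^ 3 := by rw [hξb]; ring

include hξb hξc hξd hξ in
/-- **`I_ξ = (s³)`**: the augmentation ideal `(ξ u − u : u ∈ P)` of the lift is the principal ideal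
`(s³)` (every generator increment is `s³ ·` polynomial; PF-A `forall_sub_mem_of_adjoin_eq_top`).
[OURS · L1 W4.5c] -/
theorem span_rootLiftA_sub_eq :
    Ideal.span (Set.range fun u : MvPolynomial (Fin n) k => ξ u - u) = Ideal.span {X a ^ 3} := by
  apply le_antisymm
  · rw [Ideal.span_le]
    rintro _ ⟨u, rfl⟩
    refine PeelingFrame.forall_sub_mem_of_adjoin_eq_top (ξ : MvPolynomial (Fin n) k →ₐ[k] _)
      (Ideal.span {X a ^ 3}) (MvPolynomial.adjoin_range_X (σ := Fin n) (R := k)) ?_ u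
    rintro _ ⟨i, rfl⟩
    change ξ (X i) - X i ∈ Ideal.span {X a ^ 3}
    rw [Ideal.mem_span_singleton]
    by_cases hib : i = b
    · exact ⟨1, by rw [hib, hξb]; ring⟩
    by_cases hic : i = c
    · exact ⟨X b, by rw [hic, hξc]; ring⟩
    by_cases hid : i = d
    · exact ⟨X c ^ 3 - X a ^ 12 * X c, by rw [hid, hξd]; ring⟩
    · exact ⟨0, by rw [hξ i hib hic hid]; ring⟩
  · rw [Ideal.span_singleton_le_iff_mem, ← rootLiftA_sub_X_b k n a b ξ hξb]
    exact Ideal.subset_span ⟨X b, rfl⟩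

include hξb hξc hξd hξ in
/-- **Király–Lütkebohmert terminal state** on the root chart: at every prime `𝔮` (fixed or not) the
localised augmentation ideal is principal (it is `(s³)`). Shape = the `hdiv` hypothesis of
`TameTransfer.isRegularRing_fixedPoints_zpowers`. [OURS · L1 W4.5c] -/
theorem rootLiftA_KL_terminal (𝔮 : Ideal (MvPolynomial (Fin n) k)) [𝔮.IsPrime]
    (_h : 𝔮.comap ξ = 𝔮) :
    ((Ideal.span (Set.range fun u : MvPolynomial (Fin n) k => ξ u - u)).map
      (algebraMap (MvPolynomial (Fin n) k) (Localization.AtPrime 𝔮))).IsPrincipal := by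
  rw [span_rootLiftA_sub_eq k n a b c d ξ hξb hξc hξd hξ, Ideal.map_span, Set.image_singleton]
  exact ⟨⟨_, rfl⟩⟩

include hξb in
/-- `ξ ≠ 1` (`ξ x_b′ = x_b′ + s³ ≠ x_b′`). [folklore] -/
theorem rootLiftA_ne_one : ξ ≠ 1 := by
  intro h
  have h1 : ξ (X b) - X b = 0 := by rw [h, AlgEquiv.one_apply, sub_self]
  rw [rootLiftA_sub_X_b k n a b ξ hξb] at h1
  exact (pow_ne_zero 3 (MvPolynomial.X_ne_zero (R := k) a)) h1

include hξa hξb hξc hξd hξ in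
/-- **Z4a, K–L brick: the invariant ring of the lift on the `x_a`-root chart is REGULAR** (characteristic
`3`): `S := P^{⟨ξ⟩} = FixedPoints.subalgebra k P (zpowers ξ)` is a regular ring, by Király–Lütkebohmert
(`TameTransfer.isRegularRing_fixedPoints_zpowers`: `P` regular of finite type, `ξ ≠ 1`, `ξ³ = 1`, terminal
state `rootLiftA_KL_terminal`). Memo §2: «S := k[s,x₁′,x₂′,w]^{σ̃} is REGULAR (K–L)» — the V-BR input.
[OURS · L1 W4.5c] [cite: KiralyLutkebohmert2013, Thm 2] -/
theorem rootLiftA_fixedPoints_isRegularRing [CharP k 3] :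
    IsRegularRing (FixedPoints.subalgebra k (MvPolynomial (Fin n) k) (Subgroup.zpowers ξ)) :=
  TameTransfer.isRegularRing_fixedPoints_zpowers Nat.prime_three ξ
    (rootLiftA_ne_one k n a b ξ hξb)
    (rootLiftA_pow_three_eq_one k n a b c d ξ hξa hξb hξc hξd hξ)
    (fun 𝔮 _ h𝔮 => rootLiftA_KL_terminal k n a b c d ξ hξb hξc hξd hξ 𝔮 h𝔮)

end Summit.ResolutionOfSingularities.ResolutionOfSingularities.Theorems.WildQuotientResolution.Z9Peeled

end
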